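import Summits.HodgeConjecture.HodgeConjecture.Theses.EisensteinMiddleThird
import Literature.AlgebraicGeometry.HodgeTheory.MiddleDimensionReductionProofs
import Literature.AlgebraicGeometry.HodgeTheory.HodgeTypeExteriorProduct
import Literature.AlgebraicGeometry.HodgeTheory.ComplexConjugationHolds

/-!
# STRATEGY CENSUS companion — `EisensteinMiddleThird.SectorComplement` (stmt-HodgeConjecture-14414)

Crux-strategist r1 (redirect pass, likely-fail scan `f:reaudit(RESTATED)`), seat
`planner-cstrat-stmt-HodgeConjecture-14414-r1-0`, 2026-08-17. Companion of
`Cruxes/SectorComplement/STRATEGY-CENSUS-14414.md`. Nothing here asserts a Theses decl: every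
statement is an implication FROM the summit, an equivalence, or a theorem about honest readings of
"the complement of the sector". `T` := `EisensteinTowerHodge` (the route target: HC on every smooth
projective birational model of every congruence cover of the Eisenstein Picard-modular 4-ball
quotient), `C` := `SectorComplement := T → HodgeConjecture`, `S` := `_root_.HodgeConjecture`.

* §1 truth table / costume: `S → C`, `S → T`, **`C ↔ (T ↔ S)`** (the crux SAYS "the route target is
  equivalent to the summit", i.e. the universality of the Eisenstein tower for HC),
  `C ↔ (¬S → ¬T)`, `S ↔ T ∧ C`, `¬C ↔ T ∧ ¬S`, `C ↔ ¬T ∨ S`.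
* §2 the HONEST complement is the summit, kernel-checked with NO unproved fact: the sector consists
  of fourfolds, and HC in dimension 5 already gives HC in dimension 4 (`X ↦ X × ℙ¹`, the tree's
  proved ℙ¹-step of BFNP Lemma 48), so `OffDimFour` (:= HC in every dimension ≠ 4) `↔ S` and the
  honest off-sector statement `OffSector ↔ S`.
* §3 law of lines and of splits: `(P → C) ↔ (P ∧ T → S)`; residual of a T-using split.
* §4 transfer attempt (dominant descent, the one lever that USES `T` off the sector): its residual
  is the crux again.
* §5 strengthenings; §6 negation shape.
-/

set_option linter.dupNamespace false
set_option autoImplicit false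

noncomputable section

open scoped Matrix Manifold BigOperators
open CategoryTheory MonoidalCategory CartesianMonoidalCategory
open Literature.AlgebraicGeometry Literature.AlgebraicGeometry.Motives
open Literature.AlgebraicGeometry.HodgeTheory

namespace Summit.HodgeConjecture.HodgeConjecture.Cruxes.SectorComplement.StrategyCensus.EisensteinMiddleThird

open Summit.HodgeConjecture.HodgeConjecture.Theses.EisensteinMiddleThird

/-! ## §1 Truth table — the crux is "T ↔ S" -/

/-- The route target is a special case of the summit (sector varieties are smooth projective
fourfolds). This is the `S → T` half that makes `C` say "T ↔ S". -/
theorem tower_of_summit (hS : _root_.HodgeConjecture) : EisensteinTowerHodge :=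
  fun _X hX _ ↦ hS hX

/-- BC2 converse probe `S → C`, by a term: the crux is a CONSEQUENCE of the summit. -/
theorem sectorComplement_of_summit (hS : _root_.HodgeConjecture) : SectorComplement :=
  fun _ ↦ hS

/-- **Costume theorem.** `SectorComplement ↔ (EisensteinTowerHodge ↔ HodgeConjecture)`: the crux
asserts exactly that HC on the Eisenstein Picard-modular tower is EQUIVALENT to the full Hodge
conjecture (universality of one countable family of fourfolds for HC in all dimensions). -/
theorem sectorComplement_iff_tower_iff_summit :
    SectorComplement ↔ (EisensteinTowerHodge ↔ _root_.HodgeConjecture) :=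
  ⟨fun hC ↦ ⟨hC, tower_of_summit⟩, fun h ↦ h.1⟩

/-- Universality reading: `C ↔ (¬S → ¬T)` — "if HC fails anywhere, in any dimension, it already
fails on some compactified congruence cover of the moduli space of cubic surfaces". -/
theorem sectorComplement_iff_contrapositive :
    SectorComplement ↔ (¬ _root_.HodgeConjecture → ¬ EisensteinTowerHodge) :=
  ⟨fun hC hnS hT ↦ hnS (hC hT), fun h hT ↦ Classical.byContradiction fun hnS ↦ h hnS hT⟩

/-- `S ↔ T ∧ C`: the crux is precisely "the summit minus the route target" (bridge split
`T ∧ (T → S)`; `closes` is modus ponens). -/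
theorem summit_iff_tower_and_sectorComplement :
    _root_.HodgeConjecture ↔ EisensteinTowerHodge ∧ SectorComplement :=
  ⟨fun hS ↦ ⟨tower_of_summit hS, sectorComplement_of_summit hS⟩, fun h ↦ h.2 h.1⟩

/-- Kill shape: `¬C ↔ T ∧ ¬S` — a refutation of the crux must PROVE HC on the whole Eisenstein tower
and DISPROVE the Hodge conjecture elsewhere. -/
theorem not_sectorComplement_iff :
    ¬ SectorComplement ↔ EisensteinTowerHodge ∧ ¬ _root_.HodgeConjecture := by
  constructor
  · intro h
    have hnS : ¬ _root_.HodgeConjecture := fun hS ↦ h (sectorComplement_of_summit hS)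
    exact ⟨Classical.byContradiction fun hnT ↦ h fun hT ↦ absurd hT hnT, hnS⟩
  · rintro ⟨hT, hnS⟩ hC
    exact hnS (hC hT)

/-- Truth table: `C ↔ ¬T ∨ S`. A proof of the crux is (classically) a proof of "HC, or a
non-algebraic rational Hodge class on the Eisenstein tower". -/
theorem sectorComplement_iff_not_tower_or :
    SectorComplement ↔ ¬ EisensteinTowerHodge ∨ _root_.HodgeConjecture := by
  constructor
  · intro hC
    by_cases hT : EisensteinTowerHodge
    · exact Or.inr (hC hT)
    · exact Or.inl hT
  · rintro (hnT | hS) hT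
    · exact absurd hT hnT
    · exact hS

/-- Modulo the route target the crux IS the summit. -/
theorem sectorComplement_iff_summit_of_tower (hT : EisensteinTowerHodge) :
    SectorComplement ↔ _root_.HodgeConjecture :=
  ⟨fun hC ↦ hC hT, sectorComplement_of_summit⟩

/-! ## §2 The honest complement of a sector of FOURFOLDS is the full Hodge conjecture

The Eisenstein sector consists of smooth projective varieties of dimension 4 (`IsSmoothProjective 4 X`
plus the ball-quotient datum). "HC off the sector", read honestly, therefore CONTAINS HC in every
dimension `n ≠ 4`; and HC in dimension 5 alone already returns HC in dimension 4 by the product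
trick `X ↦ X × ℙ¹` — the ℙ¹-step of Brosnan–Fang–Nie–Pearlstein Lemma 48, PROVED in the tree
(`mem_algebraicClasses_of_projectiveLine_of_preservesHodgeType`, pull-backs only, fed with the
theorems `preservesHodgeType_of_isSmoothProjective`, `IsSmoothProjective.tensor_holds`,
`isSmoothProjective_projectiveSpace_holds`, `nonempty_hodgeModel_holds`). -/

/-- HC in every dimension other than 4 — the weakest honest reading of "HC off a sector of
fourfolds". -/
def OffDimFour : Prop :=
  ∀ ⦃n : ℕ⦄ ⦃X : SchemeOver ℂ⦄, n ≠ 4 → IsSmoothProjective n X → HodgeConjectureFor n X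

/-- **HC for the fivefold `X × ℙ¹` gives HC for the fourfold `X`** (all codimensions), with no
unproved input. [cite: BrosnanFangNiePearlstein2009, §6 Lemma 48 (proof)] -/
theorem hodgeConjectureFor_of_projectiveLine {n : ℕ} {X : SchemeOver ℂ}
    (hX : IsSmoothProjective n X)
    (h : HodgeConjectureFor (n + 1) (X ⊗ projectiveSpace 1 ℂ)) : HodgeConjectureFor n X := by
  have hP : IsSmoothProjective 1 (projectiveSpace 1 ℂ) := isSmoothProjective_projectiveSpace_holds ℂ 1
  have hXP : IsSmoothProjective (n + 1) (X ⊗ projectiveSpace 1 ℂ) :=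
    IsSmoothProjective.tensor_holds hX hP
  refine ⟨nonempty_hodgeModel_holds hX, fun p c hc hpp ↦ ?_⟩
  exact mem_algebraicClasses_of_projectiveLine_of_preservesHodgeType hX
    (preservesHodgeType_of_isSmoothProjective hXP hX (fst X (projectiveSpace 1 ℂ)))
    (fun κ hκ hκpp ↦ h.2 p κ hκ hκpp) c hc hpp

/-- **`OffDimFour ↔ HodgeConjecture`**: excluding ALL fourfolds from the Hodge conjecture loses
nothing. A fortiori excluding the Eisenstein Picard-modular fourfolds loses nothing. -/
theorem offDimFour_iff_summit : OffDimFour ↔ _root_.HodgeConjecture := by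
  constructor
  · intro h n X hX
    by_cases hn : n = 4
    · subst hn
      have hP : IsSmoothProjective 1 (projectiveSpace 1 ℂ) :=
        isSmoothProjective_projectiveSpace_holds ℂ 1
      exact hodgeConjectureFor_of_projectiveLine hX
        (h (by norm_num) (IsSmoothProjective.tensor_holds hX hP))
    · exact h hn hX
  · intro hS n X _ hX
    exact hS hX

/-- Membership of `X` (smooth projective of dimension `n`) in the route's sector: `n = 4` and the
inline Eisenstein Picard-modular datum of `EisensteinTowerHodge`, VERBATIM. -/
def InEisensteinSector (n : ℕ) (X : SchemeOver ℂ) : Prop :=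
  n = 4 ∧ ∃ (A : Literature.AlgebraicGeometry.HodgeTheory.HodgeModel 4 X) (Z : Set X.left) (S : Set (Matrix (Fin 5) (Fin 5) ℂ)) (N : ℕ) (π : EuclideanSpace ℂ (Fin 4) → A.carrier), IsClosed Z ∧ 0 < N ∧ (∀ γ ∈ S, (∀ i j, ∃ a b : ℤ, γ i j = (a : ℂ) + (b : ℂ) * ((-1 + Complex.I * (Real.sqrt 3 : ℂ)) / 2)) ∧ γᴴ * Matrix.diagonal ![(1 : ℂ), -1, -1, -1, -1] * γ = Matrix.diagonal ![(1 : ℂ), -1, -1, -1, -1]) ∧ (∀ γ : Matrix (Fin 5) (Fin 5) ℂ, (∀ i j, ∃ a b : ℤ, γ i j - (1 : Matrix (Fin 5) (Fin 5) ℂ) i j = (N : ℂ) * ((a : ℂ) + (b : ℂ) * ((-1 + Complex.I * (Real.sqrt 3 : ℂ)) / 2))) → γᴴ * Matrix.diagonal ![(1 : ℂ), -1, -1, -1, -1] * γ = Matrix.diagonal ![(1 : ℂ), -1, -1, -1, -1] → γ ∈ S) ∧ (∀ z ∈ Metric.ball (0 : EuclideanSpace ℂ (Fin 4)) 1, MDifferentiableAt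 𝓘(ℂ, EuclideanSpace ℂ (Fin 4)) 𝓘(ℂ, A.model) π z) ∧ (∃ h : Set.MapsTo π (Metric.ball (0 : EuclideanSpace ℂ (Fin 4)) 1) {x : A.carrier | (A.toComplexPoints x).pt ∉ Z}, IsCoveringMap h.restrict ∧ Function.Surjective h.restrict) ∧ (∀ z ∈ Metric.ball (0 : EuclideanSpace ℂ (Fin 4)) 1, ∀ w ∈ Metric.ball (0 : EuclideanSpace ℂ (Fin 4)) 1, π z = π w ↔ ∃ γ ∈ S, ∀ i : Fin 4, EuclideanSpace.equiv (Fin 4) ℂ w i * (γ 0 0 + ∑ j : Fin 4, γ 0 (Fin.succ j) * EuclideanSpace.equiv (Fin 4) ℂ z j) = γ (Fin.succ i) 0 + ∑ j : Fin 4, γ (Fin.succ i) (Fin.succ j) * EuclideanSpace.equiv (Fin 4) ℂ z j)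

/-- The HONEST complement of the sector: HC for every smooth projective variety NOT in the sector. -/
def OffSector : Prop :=
  ∀ ⦃n : ℕ⦄ ⦃X : SchemeOver ℂ⦄, IsSmoothProjective n X → ¬ InEisensteinSector n X → HodgeConjectureFor n X

/-- The honest complement contains HC in every dimension `≠ 4`. -/
theorem offDimFour_of_offSector (h : OffSector) : OffDimFour :=
  fun _n _X hn hX ↦ h hX fun hin ↦ hn hin.1

/-- **The honest complement is the summit**: `OffSector ↔ HodgeConjecture`, kernel-checked. So
"HC off the Eisenstein sector" is not a residual at all — it is the whole Hodge conjecture, and the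
route's `T` buys nothing toward it. -/
theorem offSector_iff_summit : OffSector ↔ _root_.HodgeConjecture :=
  ⟨fun h ↦ offDimFour_iff_summit.1 (offDimFour_of_offSector h), fun hS _ _ hX _ ↦ hS hX⟩

/-- The honest complement implies the typed crux (and not conversely without `T`): the route typed
the WEAKEST statement that closes with `T`, namely `T → S`; every stronger honest reading is
literally `S`. -/
theorem sectorComplement_of_offSector (h : OffSector) : SectorComplement :=
  sectorComplement_of_summit (offSector_iff_summit.1 h)

/-- The crux is equivalent to "HC on the Eisenstein tower (fourfolds) implies HC in every dimension
other than 4" — the hypothesis and the conclusion live in disjoint dimensions. -/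
theorem sectorComplement_iff_tower_imp_offDimFour :
    SectorComplement ↔ (EisensteinTowerHodge → OffDimFour) :=
  ⟨fun hC hT ↦ offDimFour_iff_summit.2 (hC hT), fun h hT ↦ offDimFour_iff_summit.1 (h hT)⟩

/-! ## §3 Law of lines and of splits -/

/-- **Law of lines.** Any stub set / hypothesis `P` concluding the crux is a proof of the summit
from `P ∧ T`: `(P → C) ↔ (P ∧ T → S)`. -/
theorem law_of_lines (P : Prop) :
    (P → SectorComplement) ↔ (P ∧ EisensteinTowerHodge → _root_.HodgeConjecture) :=
  ⟨fun h hp ↦ h hp.1 hp.2, fun h hP hT ↦ h ⟨hP, hT⟩⟩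

/-- **Law of splits.** A decomposition `X₁ → X₂ → C` is a proof of HC from `X₁ ∧ X₂ ∧ T`. Either no
piece uses `T` (Family A: the pieces prove `S` outright — a decomposition of the SUMMIT, some other
route's item list, `T` decorative), or some piece consumes `T` (Family B: a transfer of HC from the
Eisenstein tower to other varieties). -/
theorem law_of_splits (X₁ X₂ : Prop) :
    (X₁ → X₂ → SectorComplement) ↔ (X₁ ∧ X₂ ∧ EisensteinTowerHodge → _root_.HodgeConjecture) :=
  ⟨fun h hx ↦ h hx.1 hx.2.1 hx.2.2, fun h h₁ h₂ hT ↦ h ⟨h₁, h₂, hT⟩⟩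

/-- Family-B anatomy. A `T`-using split has the shape `(T → E) ∧ (E → S)` for the REACH `E` of the
lever. If `E` contains the tower (`E → T`, automatic when `E` is "HC on a class of varieties
containing the sector"), the residual `E → S` is implied by the crux … -/
theorem residual_of_sectorComplement {E : Prop} (hET : E → EisensteinTowerHodge) :
    SectorComplement → (E → _root_.HodgeConjecture) :=
  fun hC hE ↦ hC (hET hE)

/-- … and is EQUIVALENT to the crux as soon as the transfer piece `T → E` is available: so in every
`T`-using split whose transfer piece is a theorem, the residual piece is the crux in costume
(fails BC2 (c)); and if the transfer piece is itself open, the split has TWO unplanned pieces. -/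
theorem residual_iff_sectorComplement {E : Prop} (hTE : EisensteinTowerHodge → E)
    (hET : E → EisensteinTowerHodge) : (E → _root_.HodgeConjecture) ↔ SectorComplement :=
  ⟨fun h hT ↦ h (hTE hT), residual_of_sectorComplement hET⟩

/-- Family-B assembly (trivially valid for any reach `E`). -/
theorem sectorComplement_of_transfer_of_residual {E : Prop} (hTE : EisensteinTowerHodge → E)
    (hres : E → _root_.HodgeConjecture) : SectorComplement :=
  fun hT ↦ hres (hTE hT)

/-! ## §4 Transfer — the one lever that uses `T` off the sector: descent along dominant maps

HC descends along surjective morphisms of smooth projective varieties (`f_* (f^* c ∪ h^r) = deg · c`,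
Kleiman / Fulton 19.1; printed, not yet a tree fact — carried as the hypothesis `DominantDescent`).
Its reach from the tower is the class of varieties DOMINATED by a sector fourfold: dimension ≤ 4,
and in dimension ≤ 3 HC is a theorem anyway. -/

/-- Descent of HC along surjective morphisms between smooth projective varieties (Kleiman 1968 /
Fulton Ex. 19.1.x; stated as a hypothesis, not asserted). -/
def DominantDescent : Prop :=
  ∀ ⦃m n : ℕ⦄ ⦃X Y : SchemeOver ℂ⦄ (f : X ⟶ Y), IsSmoothProjective m X → IsSmoothProjective n Y →
    Function.Surjective f.left.base → HodgeConjectureFor m X → HodgeConjectureFor n Y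

/-- `Y` is dominated by the Eisenstein tower: the target of a surjective morphism from a sector
fourfold. -/
def TowerDominated (Y : SchemeOver ℂ) : Prop :=
  ∃ (X : SchemeOver ℂ) (f : X ⟶ Y), IsSmoothProjective 4 X ∧ InEisensteinSector 4 X ∧
    Function.Surjective f.left.base

/-- HC for every smooth projective variety dominated by the tower — the exact REACH of `T` under
dominant descent. -/
def HCDominated : Prop :=
  ∀ ⦃n : ℕ⦄ ⦃Y : SchemeOver ℂ⦄, IsSmoothProjective n Y → TowerDominated Y → HodgeConjectureFor n Y

/-- Transfer piece: granted dominant descent, `T` reaches every variety dominated by the tower. -/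
theorem hcDominated_of_tower (hD : DominantDescent) (hT : EisensteinTowerHodge) : HCDominated := by
  rintro n Y hY ⟨X, f, hX, ⟨-, hsec⟩, hf⟩
  exact hD f hX hY hf (hT hX hsec)

/-- The reach contains the tower (identity map). -/
theorem tower_of_hcDominated (h : HCDominated) : EisensteinTowerHodge := by
  intro X hX hsec
  exact h hX ⟨X, 𝟙 X, hX, ⟨rfl, hsec⟩, fun x ↦ ⟨x, rfl⟩⟩

/-- **The residual of the dominant-descent split is the crux itself** (granted the printed descent
theorem): `(HCDominated → S) ↔ C`. So the only `T`-using decomposition available fails BC2 (c) —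
its open piece is `SectorComplement` reworded (sector enlarged from "the tower" to "everything the
tower dominates", still fourfolds-and-below). -/
theorem dominated_residual_iff (hD : DominantDescent) :
    (HCDominated → _root_.HodgeConjecture) ↔ SectorComplement :=
  residual_iff_sectorComplement (hcDominated_of_tower hD) tower_of_hcDominated

/-! ## §5 Strengthenings `S⁺ ⇒ C` -/

/-- S⁺₁ = the honest complement: IS the summit (`offSector_iff_summit`). -/
theorem strengthening_offSector_is_summit : (OffSector → SectorComplement) ∧ (OffSector ↔ _root_.HodgeConjecture) :=
  ⟨sectorComplement_of_offSector, offSector_iff_summit⟩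

/-- HC for all smooth projective fourfolds. -/
def HCFour : Prop :=
  ∀ ⦃X : SchemeOver ℂ⦄, IsSmoothProjective 4 X → HodgeConjectureFor 4 X

/-- S⁺₂ = the two-step universality `(T → HC₄) ∧ (HC₄ → S)`: a valid split of the crux whose
pieces are "the Eisenstein tower is universal among fourfolds" and "fourfolds are universal for HC"
— two universality conjectures with no mechanism in print (census §Strengthen / §Decomposition). -/
theorem sectorComplement_of_fourfold_universality (h₁ : EisensteinTowerHodge → HCFour)
    (h₂ : HCFour → _root_.HodgeConjecture) : SectorComplement :=
  fun hT ↦ h₂ (h₁ hT)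

/-- The second piece is again a complement frame: implied by `S`, and giving `S` exactly when HC₄
is available — `HCFour → ((HCFour → S) ↔ S)`. -/
theorem hcFour_residual_frame : (_root_.HodgeConjecture → (HCFour → _root_.HodgeConjecture)) ∧
    (HCFour → ((HCFour → _root_.HodgeConjecture) ↔ _root_.HodgeConjecture)) :=
  ⟨fun hS _ ↦ hS, fun h4 ↦ ⟨fun h ↦ h h4, fun hS _ ↦ hS⟩⟩

/-- S⁺₃ = any `T`-free strengthening `P` (Family A): `P → C` iff `P ∧ T → S`; when `P` does not
mention the tower the only way to use it is `P → S` — a summit thesis. Recorded as the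
specialisation of the law of lines. -/
theorem tfree_strengthening (P : Prop) (h : P → _root_.HodgeConjecture) : P → SectorComplement :=
  fun hP ↦ sectorComplement_of_summit (h hP)

/-! ## §6 Negation — what a counterexample to the crux is -/

/-- A counterexample to `C` is a PROOF of HC on the whole Eisenstein tower together with a DISPROOF
of the Hodge conjecture (necessarily off the tower, and by §2 it may be taken in dimension ≠ 4 or on
a non-ball-quotient fourfold): strictly more than a disproof of HC. -/
theorem counterexample_shape :
    ¬ SectorComplement ↔ EisensteinTowerHodge ∧ ∃ (n : ℕ) (X : SchemeOver ℂ),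
      IsSmoothProjective n X ∧ ¬ HodgeConjectureFor n X := by
  rw [not_sectorComplement_iff]
  refine and_congr_right fun _ ↦ ?_
  constructor
  · intro hnS
    by_contra hall
    apply hnS
    intro n X hX
    by_contra hX'
    exact hall ⟨n, X, hX, hX'⟩
  · rintro ⟨n, X, hX, hnX⟩ hS
    exact hnX (hS hX)

/-- Any refutation of the crux refutes the formal summit. -/
theorem not_summit_of_not_sectorComplement (h : ¬ SectorComplement) : ¬ _root_.HodgeConjecture :=
  (not_sectorComplement_iff.1 h).2

end Summit.HodgeConjecture.HodgeConjecture.Cruxes.SectorComplement.StrategyCensus.EisensteinMiddleThird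

end
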